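import Literature.Probability.LatticeModels.LeeYangLatticeLaw
import Literature.MathematicalPhysics.QuantumLattice.HeisenbergOrderNeelRiemann3
import Mathlib.Analysis.Real.Pi.Bounds
import HarnessLib

/-!
# Lee–Yang lattice laws, III: the second moment, Newman's inequality, and the first-zero bound

For a Lee–Yang lattice law `p` of size `K` with product formula
`∑ p_k e^{tk} = cosh^m t ∏ᵢ (1 + bᵢ sinh² t)`, `bᵢ ≥ 1` (`LeeYangLatticeLaw.lean`), write
`u₂ = ∑ p_k k²`, `m₄ = ∑ p_k k⁴`, `u₄ = m₄ - 3u₂²` (the fourth cumulant; odd moments vanish).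

* `sum_mul_sq_eq_and_newman_ineq` — `u₂ = m + 2∑ᵢ bᵢ` and Newman's inequality
  `2m + 12∑ᵢ bᵢ² - 8∑ᵢ bᵢ ≤ 3u₂² - m₄ = -u₄` (the lattice form of `u₄ = -12∑ⱼ αⱼ⁻⁴ ≤ 0`,
  Newman's Theorem 3, eq. (2.4)): compare the two fourth-order expansions of `2 log M(t)` at `0`,
  `S₁t² + (S₁/3 - S₂/2)t⁴ + O(t⁶)` from the product (`S₁ = m + 2∑bᵢ`, `S₂ = m + 2∑bᵢ²`; the factor
  `cosh² = 1 + sinh²` has `b = 1`) and `u₂t² + (u₄/12)t⁴ + O(t⁶)` from the moments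
  (`NewmanLeeYang.expansion_le_two_log_mgfN`, `two_log_mgfN_le`, `coeff_nonpos_of_expansion_le`).
* `twelve_div_pow_four_le_of_sin_ne_zero` — the elementary inequality
  `12/θ⁴ ≤ 12/sin⁴θ - 8/sin²θ` (`θ > 0`, `sin θ ≠ 0`), i.e. `3θ⁴ - 2θ⁴sin²θ - 3sin⁴θ ≥ 0`: on
  `(0, π/2]` from `sin θ ≤ θ - θ³/6 + θ⁵/120` (`KLSNumerics.sin_le_taylor_five`) and an explicit
  polynomial inequality in `u = θ² ≤ 5/2`; for `θ > π/2` from `θ⁴ ≥ 3`.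
* `twelve_div_pow_four_le_of_sum_mul_cos_eq_zero` — **Newman's first-zero bound on the lattice**:
  at every zero `θ > 0` of `∑ p_k cos(θk) = cos^m θ ∏ᵢ (1 - bᵢ sin² θ)`,
  `12/θ⁴ ≤ 2m + 12∑bᵢ² - 8∑bᵢ ≤ -u₄` (continuum version: `12α₁⁻⁴ ≤ 12∑ⱼ αⱼ⁻⁴ = -u₄` for the zeros
  `±iαⱼ` of `E(e^{zX})`, Newman's Theorem 7).

No definitions and no named facts are introduced.

## References

* C. M. Newman, *Inequalities for Ising models and field theories which obey the Lee–Yang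
  theorem*, Comm. Math. Phys. 41 (1975) 1–9: Theorem 3 (eq. (2.4)), Theorem 4 (eq. (2.5)),
  Theorem 7 (eq. (2.13)). [Newman1975]
-/

noncomputable section

namespace Literature.Probability.LatticeModels

open Literature.Barriers.CriticalPhenomena Finset Polynomial

namespace LeeYangLatticeLaw

/-! ### The second moment and Newman's coefficient inequality -/

/-- **`u₂ = m + 2∑bᵢ` and Newman's inequality `2m + 12∑bᵢ² - 8∑bᵢ ≤ 3u₂² - ∑ p_k k⁴`.** From the
real-axis identity `M(t) = cosh^m t ∏ᵢ (1 + bᵢ sinh² t)` (`bᵢ ≥ 1`) for a symmetric lattice law: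
compare the fourth-order expansions of `2 log M(t)` at `t = 0` — from the product,
`S₁t² + (S₁/3 - S₂/2)t⁴ + O(t⁶)` with `S₁ = m + 2∑bᵢ`, `S₂ = m + 2∑bᵢ²`
(`cosh² = 1 + sinh²` is a factor with `b = 1`); from the moments, `u₂t² + (u₄/12)t⁴ + O(t⁶)` with
`u₂ = ∑ p_k k²`, `u₄ = ∑ p_k k⁴ - 3u₂²` — so `S₁ = u₂` and `S₂/2 ≤ u₂/3 - u₄/12`.
[cite: Newman1975, Theorem 3 and Theorem 4, eq. (2.4)–(2.5) (lattice form)] -/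
theorem sum_mul_sq_eq_and_newman_ineq (K : ℕ) (p : ℤ → ℝ) (h0 : ∀ k, 0 ≤ p k)
    (hsymm : ∀ k, p (-k) = p k) (hpar : ∀ k : ℤ, ¬ (2 ∣ (k + K)) → p k = 0)
    (hsum : ∑ k ∈ Icc (-(K : ℤ)) K, p k = 1) {m n : ℕ} {b : Fin n → ℝ} (hb : ∀ i, 1 ≤ b i)
    (h : ∀ t : ℝ, ∑ k ∈ Icc (-(K : ℤ)) K, p k * Real.exp (t * k) =
      Real.cosh t ^ m * ∏ i, (1 + b i * Real.sinh t ^ 2)) :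
    ((m : ℝ) + 2 * ∑ i, b i = ∑ k ∈ Icc (-(K : ℤ)) K, p k * (k : ℝ) ^ 2) ∧
    (2 * (m : ℝ) + 12 * ∑ i, b i ^ 2 - 8 * ∑ i, b i ≤
      3 * (∑ k ∈ Icc (-(K : ℤ)) K, p k * (k : ℝ) ^ 2) ^ 2 - ∑ k ∈ Icc (-(K : ℤ)) K, p k * (k : ℝ) ^ 4) := by
  classical
  obtain ⟨S, K', m', ψ, τ₁, -, hp, hmK, hψp, hψm, -, hspin, htr⟩ := exists_frame K p h0 hsymm hpar hsum
  set q : ↥S → ℝ := fun τ => p τ with hq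
  have hq1 : ∑ τ, q τ = 1 := by rw [hq, ← hsum]; exact htr p fun k hk => hk
  have hb0 : ∀ i, 0 ≤ b i := fun i => zero_le_one.trans (hb i)
  have hpos : ∀ (s : ℝ) (i : Fin n), 0 < 1 + b i * Real.sinh s ^ 2 := fun s i => by
    have := hb0 i; positivity
  -- transfer of the moment generating function and of the moments to `[-K, K]`
  have hMq : ∀ t, NewmanLeeYang.mgfN q m' K' t = ∑ k ∈ Icc (-(K : ℤ)) K, p k * Real.exp (t * k) := by
    intro t
    rw [NewmanLeeYang.mgfN, ← htr (fun k => p k * Real.exp (t * k)) (fun k hk => by simp [hk])]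
    exact Fintype.sum_congr _ _ fun τ => by rw [hspin τ]
  have hmom : ∀ j : ℕ, ∑ τ, q τ * NewmanLeeYang.spinSum m' K' τ ^ j =
      ∑ k ∈ Icc (-(K : ℤ)) K, p k * (k : ℝ) ^ j := by
    intro j
    rw [← htr (fun k => p k * (k : ℝ) ^ j) (fun k hk => by simp [hk])]
    exact Fintype.sum_congr _ _ fun τ => by rw [hspin τ]
  set u₂ : ℝ := ∑ k ∈ Icc (-(K : ℤ)) K, p k * (k : ℝ) ^ 2 with hu₂
  set m₄ : ℝ := ∑ k ∈ Icc (-(K : ℤ)) K, p k * (k : ℝ) ^ 4 with hm₄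
  -- moment side on `(0, ε)`
  set ε : ℝ := min 1 (1 / (K' + 1)) with hε
  have hε0 : 0 < ε := lt_min one_pos (by positivity)
  have hεle : ∀ s : ℝ, 0 < s → s < ε → |s| ≤ 1 ∧ |s| ≤ 1 / (K' + 1) := fun s hs0 hsε => by
    rw [abs_of_pos hs0]
    exact ⟨(hsε.trans_le (min_le_left _ _)).le, (hsε.trans_le (min_le_right _ _)).le⟩
  set C₆ : ℝ := (K' : ℝ) ^ 6 * Real.cosh 1 / 720 with hC₆
  set CE : ℝ := u₂ * m₄ / 24 + m₄ ^ 2 / 576 with hCE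
  have hE1 : ∀ s : ℝ, 0 < s → s < ε → u₂ * s ^ 2 + (m₄ - 3 * u₂ ^ 2) / 12 * s ^ 4 - CE * s ^ 6 ≤
      2 * Real.log (∑ k ∈ Icc (-(K : ℤ)) K, p k * Real.exp (s * k)) := fun s hs0 hsε => by
    have := NewmanLeeYang.expansion_le_two_log_mgfN hp hq1 ψ hψp hψm (hεle s hs0 hsε).1
    rwa [hMq, hmom 2, hmom 4] at this
  have hE2 : ∀ s : ℝ, 0 < s → s < ε →
      2 * Real.log (∑ k ∈ Icc (-(K : ℤ)) K, p k * Real.exp (s * k)) ≤ u₂ * s ^ 2 + (m₄ / 12 + 2 * C₆) * s ^ 4 :=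
    fun s hs0 hsε => by
    have := NewmanLeeYang.two_log_mgfN_le hp hq1 hmK ψ hψp hψm τ₁ (hεle s hs0 hsε).2 (hεle s hs0 hsε).1
    rwa [hMq, hmom 2, hmom 4] at this
  -- product side
  have hP : ∀ s, 2 * Real.log (∑ k ∈ Icc (-(K : ℤ)) K, p k * Real.exp (s * k)) =
      (m : ℝ) * Real.log (1 + 1 * Real.sinh s ^ 2) + 2 * ∑ i, Real.log (1 + b i * Real.sinh s ^ 2) := by
    intro s
    have hc : Real.log (1 + 1 * Real.sinh s ^ 2) = 2 * Real.log (Real.cosh s) := by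
      rw [one_mul, ← Real.cosh_sq', Real.log_pow]; norm_num
    rw [h s, Real.log_mul (pow_ne_zero _ (Real.cosh_pos s).ne') (Finset.prod_pos fun i _ => hpos s i).ne',
      Real.log_pow, Real.log_prod fun i _ => (hpos s i).ne', hc]
    ring
  set S₁ : ℝ := (m : ℝ) + 2 * ∑ i, b i with hS₁
  set S₂ : ℝ := (m : ℝ) + 2 * ∑ i, b i ^ 2 with hS₂
  set cR : ℝ → ℝ := fun c => c * NewmanLeeYang.sinhSqRem + c ^ 3 * (4 / 3 + NewmanLeeYang.sinhSqRem) ^ 3 / 3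
    with hcR
  have hP1 : ∀ s : ℝ, S₁ * s ^ 2 - S₂ / 2 * s ^ 4 ≤ 2 * Real.log (∑ k ∈ Icc (-(K : ℤ)) K, p k * Real.exp (s * k)) := by
    intro s
    rw [hP s]
    have h1 := mul_le_mul_of_nonneg_left (NewmanLeeYang.log_one_add_mul_sinh_sq_ge zero_le_one s) (Nat.cast_nonneg m)
    have h2 := Finset.sum_le_sum fun i (_ : i ∈ Finset.univ) => NewmanLeeYang.log_one_add_mul_sinh_sq_ge (hb0 i) s
    have h3 : ∑ i, (b i * s ^ 2 - b i ^ 2 * s ^ 4 / 2) = (∑ i, b i) * s ^ 2 - (∑ i, b i ^ 2) * s ^ 4 / 2 := by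
      rw [Finset.sum_sub_distrib, ← Finset.sum_div, ← Finset.sum_mul, ← Finset.sum_mul]
    rw [hS₁, hS₂]
    linarith
  have hP3 : ∀ s : ℝ, |s| ≤ 1 → 2 * Real.log (∑ k ∈ Icc (-(K : ℤ)) K, p k * Real.exp (s * k)) ≤
      S₁ * s ^ 2 + (S₁ / 3 - S₂ / 2) * s ^ 4 + ((m : ℝ) * cR 1 + 2 * ∑ i, cR (b i)) * s ^ 6 := by
    intro s hs
    rw [hP s]
    have h1 := mul_le_mul_of_nonneg_left (NewmanLeeYang.log_one_add_mul_sinh_sq_le zero_le_one hs) (Nat.cast_nonneg m)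
    have h2 := Finset.sum_le_sum fun i (_ : i ∈ Finset.univ) => NewmanLeeYang.log_one_add_mul_sinh_sq_le (hb0 i) hs
    have h3 : ∑ i, (b i * s ^ 2 + (b i / 3 - b i ^ 2 / 2) * s ^ 4 +
        (b i * NewmanLeeYang.sinhSqRem + b i ^ 3 * (4 / 3 + NewmanLeeYang.sinhSqRem) ^ 3 / 3) * s ^ 6) =
        (∑ i, b i) * s ^ 2 + ((∑ i, b i) / 3 - (∑ i, b i ^ 2) / 2) * s ^ 4 + (∑ i, cR (b i)) * s ^ 6 := by
      rw [Finset.sum_add_distrib, Finset.sum_add_distrib, ← Finset.sum_mul, ← Finset.sum_mul, ← Finset.sum_mul,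
        Finset.sum_sub_distrib, ← Finset.sum_div, ← Finset.sum_div]
    rw [hS₁, hS₂]
    have h4 : cR 1 = 1 * NewmanLeeYang.sinhSqRem + 1 ^ 3 * (4 / 3 + NewmanLeeYang.sinhSqRem) ^ 3 / 3 := rfl
    rw [h4]
    linarith
  -- comparison of the two expansions
  have hB := NewmanLeeYang.coeff_nonpos_of_expansion_le (α := u₂ - S₁)
    (β := (m₄ - 3 * u₂ ^ 2) / 12 - (S₁ / 3 - S₂ / 2)) (γ := CE + ((m : ℝ) * cR 1 + 2 * ∑ i, cR (b i))) hε0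
    fun s hs0 hsε => by
      have h1 := hE1 s hs0 hsε
      have h2 := hP3 s (hεle s hs0 hsε).1
      nlinarith
  have hA : S₁ - u₂ ≤ 0 := by
    refine (NewmanLeeYang.coeff_nonpos_of_expansion_le (β := -(S₂ / 2) - (m₄ / 12 + 2 * C₆)) (γ := 0) hε0
      fun s hs0 hsε => ?_).1
    have h1 := hP1 s
    have h2 := hE2 s hs0 hsε
    nlinarith
  have hS₁u : S₁ = u₂ := by linarith [hB.1]
  have hS₂u : S₂ / 2 ≤ u₂ / 3 - (m₄ - 3 * u₂ ^ 2) / 12 := by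
    have := hB.2 (by linarith)
    rw [hS₁u] at this
    linarith
  refine ⟨hS₁u, ?_⟩
  rw [hS₁, hS₂] at *
  nlinarith [hS₂u, hS₁u]

/-! ### The elementary inequality behind the first-zero bound -/

/-- **`12/θ⁴ ≤ 12/sin⁴θ - 8/sin²θ`** for `θ > 0` with `sin θ ≠ 0`. Equivalently
`3θ⁴ - 2θ⁴ sin²θ - 3 sin⁴θ ≥ 0`; on `(0, π/2]` this follows from `sin θ ≤ θ - θ³/6 + θ⁵/120`
(the left side is decreasing in `sin θ`, and at `s = θ(1 - u/6 + u²/120)`, `u = θ²`, it equals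
`θ⁴u² R(u)` with `R(u) = 1/15 + u/60 - 137u²/21600 + u³/1350 - u⁴/24000 + u⁵/864000 - u⁶/69120000 > 0`
for `u ≤ 5/2`); for `θ > π/2` it follows from `θ⁴ ≥ 3` and `sin² θ ≤ 1`. [folklore] -/
theorem twelve_div_pow_four_le_of_sin_ne_zero {θ : ℝ} (hθ : 0 < θ) (hs : Real.sin θ ≠ 0) :
    12 / θ ^ 4 ≤ 12 / Real.sin θ ^ 4 - 8 / Real.sin θ ^ 2 := by
  set s := Real.sin θ with hsdef
  have hs2 : 0 < s ^ 2 := by positivity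
  have hs1 : s ^ 2 ≤ 1 := Real.sin_sq_le_one θ
  have hφ : 0 ≤ 3 * θ ^ 4 - 2 * θ ^ 4 * s ^ 2 - 3 * s ^ 4 := by
    rcases le_or_gt θ (Real.pi / 2) with hle | hlt
    · have hspos : 0 < s := Real.sin_pos_of_pos_of_lt_pi hθ (by linarith [Real.pi_pos])
      have hsw : s ≤ θ - θ ^ 3 / 6 + θ ^ 5 / 120 :=
        Literature.MathematicalPhysics.QuantumLattice.KLSNumerics.sin_le_taylor_five hθ.le
      have hθ2 : θ ^ 2 ≤ 5 / 2 := by have := Real.pi_lt_d2; nlinarith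
      have hq0 : 0 < 1 - θ ^ 2 / 6 + θ ^ 4 / 120 := by nlinarith [sq_nonneg (θ ^ 2 - 10)]
      have hw0 : 0 ≤ θ * (1 - θ ^ 2 / 6 + θ ^ 4 / 120) := by positivity
      have hsw' : s ≤ θ * (1 - θ ^ 2 / 6 + θ ^ 4 / 120) := by linarith
      have hs2w : s ^ 2 ≤ θ ^ 2 * (1 - θ ^ 2 / 6 + θ ^ 4 / 120) ^ 2 := by
        calc s ^ 2 ≤ (θ * (1 - θ ^ 2 / 6 + θ ^ 4 / 120)) ^ 2 := pow_le_pow_left₀ hspos.le hsw' 2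
          _ = _ := by ring
      have hs4w : s ^ 4 ≤ θ ^ 4 * (1 - θ ^ 2 / 6 + θ ^ 4 / 120) ^ 4 := by
        calc s ^ 4 = (s ^ 2) ^ 2 := by ring
          _ ≤ (θ ^ 2 * (1 - θ ^ 2 / 6 + θ ^ 4 / 120) ^ 2) ^ 2 := pow_le_pow_left₀ hs2.le hs2w 2
          _ = _ := by ring
      -- the polynomial `R(u)`, `u = θ²`, is positive on `[0, 5/2]`
      have hu0 : 0 ≤ θ ^ 2 := sq_nonneg θ
      have hR : 0 ≤ 1 / 15 + θ ^ 2 / 60 - 137 * (θ ^ 2) ^ 2 / 21600 + (θ ^ 2) ^ 3 / 1350 -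
          (θ ^ 2) ^ 4 / 24000 + (θ ^ 2) ^ 5 / 864000 - (θ ^ 2) ^ 6 / 69120000 := by
        have hu2 : (θ ^ 2) ^ 2 ≤ (5 / 2) ^ 2 := pow_le_pow_left₀ hu0 hθ2 2
        have hu4 : (θ ^ 2) ^ 4 ≤ (5 / 2) ^ 4 := pow_le_pow_left₀ hu0 hθ2 4
        have hu6 : (θ ^ 2) ^ 6 ≤ (5 / 2) ^ 6 := pow_le_pow_left₀ hu0 hθ2 6
        have hu3 : 0 ≤ (θ ^ 2) ^ 3 := by positivity
        have hu5 : 0 ≤ (θ ^ 2) ^ 5 := by positivity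
        nlinarith
      have key : 3 * θ ^ 4 - 2 * θ ^ 4 * (θ ^ 2 * (1 - θ ^ 2 / 6 + θ ^ 4 / 120) ^ 2) -
          3 * (θ ^ 4 * (1 - θ ^ 2 / 6 + θ ^ 4 / 120) ^ 4) =
          θ ^ 4 * (θ ^ 2) ^ 2 * (1 / 15 + θ ^ 2 / 60 - 137 * (θ ^ 2) ^ 2 / 21600 + (θ ^ 2) ^ 3 / 1350 -
            (θ ^ 2) ^ 4 / 24000 + (θ ^ 2) ^ 5 / 864000 - (θ ^ 2) ^ 6 / 69120000) := by ring
      have h4 : 0 ≤ θ ^ 4 := by positivity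
      nlinarith [mul_le_mul_of_nonneg_left hs2w h4, mul_nonneg (mul_nonneg h4 (sq_nonneg (θ ^ 2))) hR]
    · have hθ4 : 3 ≤ θ ^ 4 := by
        have h1 : 1.57 < θ := by have := Real.pi_gt_d2; linarith
        have h2 : 2.4649 < θ ^ 2 := by nlinarith
        have h4 : θ ^ 4 = θ ^ 2 * θ ^ 2 := by ring
        rw [h4]
        nlinarith
      have hs4 : s ^ 4 ≤ 1 := by nlinarith
      nlinarith
  rw [div_sub_div _ _ (by positivity) (by positivity), div_le_div_iff₀ (by positivity) (by positivity)]
  nlinarith [mul_nonneg hs2.le hφ]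

/-! ### Newman's first-zero bound -/

/-- **First-zero bound.** If `∑ p_k cos(θk) = cos^m θ ∏ᵢ (1 - bᵢ sin² θ)` with `bᵢ ≥ 1` and
`2m + 12∑bᵢ² - 8∑bᵢ ≤ V`, then `12/θ⁴ ≤ V` at every zero `θ > 0` of `∑ p_k cos(θk)`: either
`cos θ = 0` (`m ≥ 1`, `θ ≥ π/2`, `12/θ⁴ < 2 ≤ 2m`) or `bᵢ sin² θ = 1` for some `i`
(`12bᵢ² - 8bᵢ = 12/sin⁴θ - 8/sin²θ ≥ 12/θ⁴`, the other terms being non-negative). The continuum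
version is `α₁⁻⁴ ≤ ∑ αⱼ⁻⁴ = -u₄/12` for the zeros `±iαⱼ` of `E(e^{zX})`.
[cite: Newman1975, Theorem 3, eq. (2.4) with Theorem 7 (lattice form)] -/
theorem twelve_div_pow_four_le_of_sum_mul_cos_eq_zero {K : ℕ} {p : ℤ → ℝ} {m n : ℕ} {b : Fin n → ℝ}
    {V : ℝ} (hb : ∀ i, 1 ≤ b i)
    (hcos : ∀ θ : ℝ, ∑ k ∈ Icc (-(K : ℤ)) K, p k * Real.cos (θ * k) =
      Real.cos θ ^ m * ∏ i, (1 - b i * Real.sin θ ^ 2))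
    (hV : 2 * (m : ℝ) + 12 * ∑ i, b i ^ 2 - 8 * ∑ i, b i ≤ V) {θ : ℝ} (hθ : 0 < θ)
    (hz : ∑ k ∈ Icc (-(K : ℤ)) K, p k * Real.cos (θ * k) = 0) : 12 / θ ^ 4 ≤ V := by
  rw [hcos θ] at hz
  have hterm : ∀ i, 0 ≤ 12 * b i ^ 2 - 8 * b i := fun i => by nlinarith [hb i]
  have hsum12 : 12 * ∑ i, b i ^ 2 - 8 * ∑ i, b i = ∑ i, (12 * b i ^ 2 - 8 * b i) := by
    rw [Finset.sum_sub_distrib, Finset.mul_sum, Finset.mul_sum]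
  have hsum0 : 0 ≤ ∑ i, (12 * b i ^ 2 - 8 * b i) := Finset.sum_nonneg fun i _ => hterm i
  rcases mul_eq_zero.1 hz with h | h
  · -- `cos θ = 0`, `m ≥ 1`
    have hm : m ≠ 0 := by rintro rfl; simp at h
    have hc : Real.cos θ = 0 := (pow_eq_zero_iff hm).1 h
    obtain ⟨j, hj⟩ := Real.cos_eq_zero_iff.1 hc
    have hj0 : (0 : ℝ) ≤ j := by
      by_contra hneg
      have hj1 : (j : ℝ) ≤ -1 := by
        have : j ≤ -1 := by
          have : (j : ℝ) < 0 := not_le.1 hneg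
          exact Int.le_sub_one_iff.2 (by exact_mod_cast this)
        exact_mod_cast this
      nlinarith [Real.pi_pos]
    have hθ1 : 1.57 < θ := by have := Real.pi_gt_d2; nlinarith [Real.pi_pos]
    have hθ4 : 6 < θ ^ 4 := by
      have h2 : 2.4649 < θ ^ 2 := by nlinarith
      have h4 : θ ^ 4 = θ ^ 2 * θ ^ 2 := by ring
      rw [h4]
      nlinarith
    have h12 : 12 / θ ^ 4 ≤ 2 := by rw [div_le_iff₀ (by positivity)]; linarith
    have hm1 : (1 : ℝ) ≤ m := by exact_mod_cast Nat.one_le_iff_ne_zero.2 hm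
    linarith
  · -- `bᵢ sin² θ = 1`
    obtain ⟨i, -, hi⟩ := Finset.prod_eq_zero_iff.1 h
    have hsin : Real.sin θ ≠ 0 := by
      intro h0; rw [h0] at hi; simp at hi
    have hE := twelve_div_pow_four_le_of_sin_ne_zero hθ hsin
    have hs2 : Real.sin θ ^ 2 ≠ 0 := pow_ne_zero 2 hsin
    have hbi : b i = 1 / Real.sin θ ^ 2 := by rw [eq_div_iff hs2]; linarith
    have h1 : 12 / Real.sin θ ^ 4 - 8 / Real.sin θ ^ 2 = 12 * b i ^ 2 - 8 * b i := by
      rw [hbi]; field_simp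
    have h2 : 12 * b i ^ 2 - 8 * b i ≤ ∑ j, (12 * b j ^ 2 - 8 * b j) :=
      Finset.single_le_sum (fun j _ => hterm j) (Finset.mem_univ i)
    have hm0 : (0 : ℝ) ≤ m := Nat.cast_nonneg m
    linarith

end LeeYangLatticeLaw

end Literature.Probability.LatticeModels
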